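import Summits.ResolutionOfSingularities.ResolutionOfSingularities.Theorems.WildConesCampaignW46ChartPoint
import Summits.ResolutionOfSingularities.ResolutionOfSingularities.Theorems.WildConesCampaignW46ChartPointDim
import Literature.AlgebraicGeometry.Resolution.BlowupStalkCharts
import HarnessLib

/-!
# [OURS · L1 W4.6, rungs (i)/(ii) — the dictionary, SCHEME HALF, brick 6] The stalk of a blowing up at a RATIONAL
# point over a regular closed point carries chart data: exceptional parameter, quotients, recentred generators of
# the maximal ideal, dimension

Cell res-hironaka (LADDER-RESOLUTION rung L, D-0089), slot W4.6, seat res-L1-s46-pv-2 (gen 2). Host: route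
`WildCones`, crux `ClassicalRegimes` (stmt-ResolutionOfSingularities-16884), `--supports … --as helper`.

HONEST FRAMING. Everything here is OURS: scheme-level bookkeeping over the tree's `IsBlowup` (universal property of
blowing up, `Blowups.lean`) and its chart presentation of stalks (`IsBlowup.exists_reesChart_stalk`,
`BlowupStalkCharts.lean`), combined with bricks 4/4b (`…ChartPoint`, `…ChartPointDim`). NOTHING here is a statement
of H. Hironaka's manuscript [Hironaka2017] and nothing of it is used; no FACT-LIST premise. AI review is weaker
than expert review.

## Statement (`exists_stalk_chartData`)

Let `π : Z′ → Z` be a blowing up along an ideal sheaf `J` (`IsBlowup π J`), `ξ′ ∈ Z′`, and suppose the stalk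
`R = 𝒪_{Z,π ξ′}` is a regular local ring whose maximal ideal IS the stalk ideal `J_{π ξ′}` (blow-up of a regular
CLOSED POINT), generated by a family `c : σ → R` with `|σ| = emb.dim R`; suppose `ξ′` is RATIONAL over `π ξ′`:
every germ at `ξ′` is congruent modulo `𝔪_{ξ′}` to a germ pulled back from `π ξ′`. Then there are a chart index
`i`, quotients `e_j ∈ 𝒪_{Z′,ξ′}` and `τ̃_j ∈ R` with

* `π^♯(c_j) = π^♯(cᵢ) · e_j` (the exceptional ideal `𝔪_R 𝒪_{Z′,ξ′}` is invertible, generated by `cᵢ`);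
* `𝔪_{Z′,ξ′} = (π^♯ cᵢ) + (e_j − π^♯ τ̃_j : j ≠ i)`;
* `𝒪_{Z′,ξ′}` is Noetherian and `|σ| ≤ dim 𝒪_{Z′,ξ′}`

— exactly the ring-level hypotheses of brick 5 (`FormalChart.exists_ringEquiv_completion_chart`,
`…FormalChartAssembly.lean`), which then yields `𝒪̂_{Z′,ξ′} ≅ κ⟦X_σ⟧` with `π̂^♯` the chart substitution in
formal coordinates adapted to `c`. Proof: `IsBlowup.exists_reesChart_stalk` presents `𝒪_{Z′,ξ′}` as a localisation
of a Rees chart `(R[𝔪t])_{(c_j t)}` at a prime over `𝔪_R`; rationality makes that prime `κ`-rational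
(`e_j ≡ τ̃_j`), and bricks 4/4b apply.

References: The Stacks Project, Tag 0804; `BlowupStalkCharts.lean`, `BlowupChartRsop.lean`; H. Hironaka, ms.
2017, Th. 16.6 p.84 — ROLE of «the blowup `π : Z′ → Z` with center `D`» only, under adjudication, not cited as
fact. [StacksProject] [folklore]
-/

noncomputable section

-- single-problem summit: the doubled namespace component `ResolutionOfSingularities` is forced
set_option linter.dupNamespace false

open CategoryTheory AlgebraicGeometry TopologicalSpace IsLocalRing

namespace Summit.ResolutionOfSingularities.ResolutionOfSingularities.Theorems

namespace CampaignW46.ChartPoint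

open Literature.AlgebraicGeometry.Resolution

universe u

/-! ## Bricks 4/4b with the localisation given by an explicit ring map

`IsBlowup.exists_reesChart_stalk` presents the stalk through a ring map `χ : B → 𝒪_{Z′,ξ′}` and the instance
`IsLocalization.AtPrime` for `χ.toAlgebra`; we restate bricks 4/4b in that form over ABSTRACT chart data (so that no
`algebraMap (chartRing c i) L` ever has to be elaborated). -/

section ChiForm

variable {R : Type u} [CommRing R] [IsRegularLocalRing R] {n : ℕ} (c : Fin n → R) (i : Fin n)
  (hz : Ideal.span (Set.range c) = maximalIdeal R) (hd : (maximalIdeal R).spanFinrank = n)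
  {A : Type u} [CommRing A] [IsNoetherianRing A] (ψ : R →+* A) (u : Fin n → A)
  (hnzd : ψ (c i) ∈ nonZeroDivisors A)
  (ε : MvPolynomial {j : Fin n // j ≠ i} (R ⧸ Ideal.span (Set.range c)) ≃+* A ⧸ Ideal.span {ψ (c i)})
  (hεC : ∀ r : R, ε (MvPolynomial.C (Ideal.Quotient.mk (Ideal.span (Set.range c)) r)) =
    Ideal.Quotient.mk _ (ψ r))
  (hεX : ∀ j : {j : Fin n // j ≠ i}, ε (MvPolynomial.X j) = Ideal.Quotient.mk _ (u j.1))
  (𝔓 : Ideal A) [𝔓.IsPrime] (h𝔓 : 𝔓.comap ψ = maximalIdeal R)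
  {L : Type u} [CommRing L] [IsLocalRing L] (χ : A →+* L)
  (hloc : @IsLocalization.AtPrime _ _ L _ χ.toAlgebra 𝔓 _)

include hloc in
omit [IsRegularLocalRing R] [IsNoetherianRing A] in
/-- `x ∈ 𝔓` iff `χ x ∈ 𝔪_L` (direction used). [folklore] -/
theorem mem_of_map_mem_maximalIdeal {x : A} (h : χ x ∈ maximalIdeal L) : x ∈ 𝔓 := by
  letI : Algebra A L := χ.toAlgebra
  haveI := hloc
  exact (IsLocalization.AtPrime.to_map_mem_maximal_iff L 𝔓 x).1 h

include hloc in
omit [IsRegularLocalRing R] [IsLocalRing L] in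
/-- A localisation of a Noetherian ring is Noetherian. [folklore] -/
theorem isNoetherianRing_of_chart : IsNoetherianRing L := by
  letI : Algebra A L := χ.toAlgebra
  haveI := hloc
  exact IsLocalization.isNoetherianRing 𝔓.primeCompl L inferInstance

include hz hεC hεX h𝔓 hloc in
omit [IsNoetherianRing A] in
/-- Brick 4 (`span_range_eq_maximalIdeal_of_rational`) in `χ`-form. [cite: StacksProject, Tag 0BIQ] [folklore] -/
theorem span_range_eq_maximalIdeal_of_rational_chi (τ : Fin n → R) (hτ : ∀ j, j ≠ i → u j - ψ (τ j) ∈ 𝔓) :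
    Ideal.span (Set.range fun j : Fin n => if j = i then χ (ψ (c i)) else χ (u j) - χ (ψ (τ j))) =
      maximalIdeal L := by
  letI : Algebra A L := χ.toAlgebra
  haveI := hloc
  exact span_range_eq_maximalIdeal_of_rational c i hz ψ u ε hεC hεX 𝔓 h𝔓 τ hτ L

include hz hd hnzd hεC hεX h𝔓 hloc in
/-- Brick 4b (`le_ringKrullDim_of_rational`) in `χ`-form. [cite: Matsumura1987, Thm. 17.4] [folklore] -/
theorem le_ringKrullDim_of_rational_chi (τ : Fin n → R) (hτ : ∀ j, j ≠ i → u j - ψ (τ j) ∈ 𝔓) :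
    (n : WithBot ℕ∞) ≤ ringKrullDim L := by
  letI : Algebra A L := χ.toAlgebra
  haveI := hloc
  exact le_ringKrullDim_of_rational c i hz hd ψ u hnzd ε hεC hεX 𝔓 h𝔓 τ hτ L

end ChiForm

/-! ## The stalk of a blowing up at a rational point -/

variable {Z Z' : Scheme.{u}} {π : Z' ⟶ Z} {J : Z.IdealSheafData}

/-- Reindexing a family along an equivalence does not change the ideal it generates. [folklore] -/
theorem span_range_comp_equiv {A : Type*} [CommSemiring A] {α β : Type*} (e : α ≃ β) (f : β → A) :
    Ideal.span (Set.range (f ∘ e)) = Ideal.span (Set.range f) := by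
  rw [e.surjective.range_comp]

/-- [OURS · L1 W4.6 — DICTIONARY, SCHEME HALF, brick 6; replaces the role of «the local ring of the blowup
`π : Z′ → Z` at a closed point `ξ′` over the centre» (H. Hironaka, ms. 2017, Th. 16.6 p.84 l.4–10) AT A RATIONAL
POINT OVER A REGULAR CLOSED POINT; NOT a statement of the manuscript] **Chart data on the stalk of a blowing up at a
rational point.** See the module docstring. [cite: StacksProject, Tag 0804] [folklore] -/
theorem exists_stalk_chartData (hπ : IsBlowup π J) (ξ' : Z')
    [IsRegularLocalRing (Z.presheaf.stalk (π ξ'))] {σ : Type} [Fintype σ] [DecidableEq σ]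
    (c : σ → Z.presheaf.stalk (π ξ'))
    (hcJ : Ideal.span (Set.range c) = stalkIdeal J (π ξ'))
    (hc𝔪 : Ideal.span (Set.range c) = maximalIdeal (Z.presheaf.stalk (π ξ')))
    (hd : (maximalIdeal (Z.presheaf.stalk (π ξ'))).spanFinrank = Fintype.card σ)
    (hrat : ∀ y : Z'.presheaf.stalk ξ', ∃ r : Z.presheaf.stalk (π ξ'),
      y - (π.stalkMap ξ').hom r ∈ maximalIdeal (Z'.presheaf.stalk ξ')) :
    ∃ (i : σ) (e : σ → Z'.presheaf.stalk ξ') (τ : σ → Z.presheaf.stalk (π ξ')),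
      (∀ j, (π.stalkMap ξ').hom (c j) = (π.stalkMap ξ').hom (c i) * e j) ∧
      Ideal.span (Set.range fun j : σ => if j = i then (π.stalkMap ξ').hom (c i)
        else e j - (π.stalkMap ξ').hom (τ j)) = maximalIdeal (Z'.presheaf.stalk ξ') ∧
      IsNoetherianRing (Z'.presheaf.stalk ξ') ∧
      (Fintype.card σ : WithBot ℕ∞) ≤ ringKrullDim (Z'.presheaf.stalk ξ') := by
  classical
  -- reindex by `Fin k`
  set k := Fintype.card σ with hk
  set eσ : σ ≃ Fin k := Fintype.equivFin σ with heσ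
  set c' : Fin k → Z.presheaf.stalk (π ξ') := c ∘ eσ.symm with hc'
  have hrange : Ideal.span (Set.range c') = Ideal.span (Set.range c) := span_range_comp_equiv eσ.symm c
  have hc'J : Ideal.span (Set.range c') = stalkIdeal J (π ξ') := hrange.trans hcJ
  have hz' : Ideal.span (Set.range c') = maximalIdeal _ := hrange.trans hc𝔪
  -- the chart presentation of the stalk
  obtain ⟨j, 𝔴, χ, hχ, hloc, h𝔴⟩ := hπ.exists_reesChart_stalk ξ' c' hc'J
  haveI : IsNoetherianRing (chartRing c' j) := isNoetherianRing_blowupChart c' j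
  have hNoeth : IsNoetherianRing (Z'.presheaf.stalk ξ') := isNoetherianRing_of_chart 𝔴.asIdeal χ hloc
  -- rationality data: `e_m ≡ τ̃_m`
  have hτex : ∀ m : Fin k, ∃ r : Z.presheaf.stalk (π ξ'),
      χ (chartGen c' j m) - (π.stalkMap ξ').hom r ∈ maximalIdeal (Z'.presheaf.stalk ξ') :=
    fun m => hrat _
  choose τ' hτ' using hτex
  have hτ𝔴 : ∀ m, m ≠ j → chartGen c' j m - chartBase c' j (τ' m) ∈ 𝔴.asIdeal := by
    intro m _
    refine mem_of_map_mem_maximalIdeal 𝔴.asIdeal χ hloc ?_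
    have hms := map_sub χ (chartGen c' j m) (chartBase c' j (τ' m))
    rw [hms, hχ]
    exact hτ' m
  have hquasi : IsQuasiRegular c' := isQuasiRegular_rsop_comp hd c' hz' id Function.injective_id
  -- bricks 4 / 4b on the Rees chart, `χ`-form
  have hgen := span_range_eq_maximalIdeal_of_rational_chi c' j hz' (chartBase c' j) (chartGen c' j)
    (chartQuotEquiv c' j hquasi) (chartQuotMap_C c' j) (chartQuotMap_X c' j) 𝔴.asIdeal h𝔴 χ hloc τ' hτ𝔴
  have hdim := le_ringKrullDim_of_rational_chi c' j hz' hd (chartBase c' j) (chartGen c' j)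
    (reesChartBase_mem_nonZeroDivisors (c' j) (Ideal.mem_span_range_self (f := c') (x := j)))
    (chartQuotEquiv c' j hquasi) (chartQuotMap_C c' j) (chartQuotMap_X c' j) 𝔴.asIdeal h𝔴 χ hloc τ' hτ𝔴
  refine ⟨eσ.symm j, fun s => χ (chartGen c' j (eσ s)), fun s => τ' (eσ s), fun s => ?_, ?_, hNoeth, hdim⟩
  · -- quotients
    have h1 : c s = c' (eσ s) := by rw [hc']; simp
    have h2 : c (eσ.symm j) = c' j := by rw [hc']; simp
    rw [h1, h2, ← hχ, ← hχ, reesChartBase_apply_eq_mul_chartGen c' j (eσ s), map_mul]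
  · -- generators, reindexed
    have hF : (fun s : σ => if s = eσ.symm j then (π.stalkMap ξ').hom (c (eσ.symm j))
        else χ (chartGen c' j (eσ s)) - (π.stalkMap ξ').hom (τ' (eσ s))) =
        (fun m : Fin k => if m = j then χ (chartBase c' j (c' j))
          else χ (chartGen c' j m) - χ (chartBase c' j (τ' m))) ∘ eσ := by
      funext s
      have h2 : c (eσ.symm j) = c' j := by rw [hc']; simp
      by_cases hs : s = eσ.symm j
      · have hs' : eσ s = j := by rw [hs]; simp
        rw [Function.comp_apply, if_pos hs, if_pos hs', hχ, h2]
      · have hs' : eσ s ≠ j := fun h => hs (by rw [← h]; simp)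
        rw [Function.comp_apply, if_neg hs, if_neg hs', hχ]
    exact (congrArg (fun F => Ideal.span (Set.range F)) hF).trans ((span_range_comp_equiv eσ _).trans hgen)

set_option maxHeartbeats 400000 in
/-- [OURS · L1 W4.6 — DICTIONARY, SCHEME HALF, brick 6, sharpened; NOT a statement of the manuscript] The chart
data of `exists_stalk_chartData` with the normalisation **`eᵢ = 1`** recorded (the quotient `cᵢ/cᵢ`), as brick 10
(`FormalChart.exists_chartData_reindex`) wants it. [cite: StacksProject, Tag 0804] [folklore] -/
theorem exists_stalk_chartData_one (hπ : IsBlowup π J) (ξ' : Z')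
    [IsRegularLocalRing (Z.presheaf.stalk (π ξ'))] {σ : Type} [Fintype σ] [DecidableEq σ]
    (c : σ → Z.presheaf.stalk (π ξ'))
    (hcJ : Ideal.span (Set.range c) = stalkIdeal J (π ξ'))
    (hc𝔪 : Ideal.span (Set.range c) = maximalIdeal (Z.presheaf.stalk (π ξ')))
    (hd : (maximalIdeal (Z.presheaf.stalk (π ξ'))).spanFinrank = Fintype.card σ)
    (hrat : ∀ y : Z'.presheaf.stalk ξ', ∃ r : Z.presheaf.stalk (π ξ'),
      y - (π.stalkMap ξ').hom r ∈ maximalIdeal (Z'.presheaf.stalk ξ')) :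
    ∃ (i : σ) (e : σ → Z'.presheaf.stalk ξ') (τ : σ → Z.presheaf.stalk (π ξ')),
      (∀ j, (π.stalkMap ξ').hom (c j) = (π.stalkMap ξ').hom (c i) * e j) ∧ e i = 1 ∧
      Ideal.span (Set.range fun j : σ => if j = i then (π.stalkMap ξ').hom (c i)
        else e j - (π.stalkMap ξ').hom (τ j)) = maximalIdeal (Z'.presheaf.stalk ξ') ∧
      IsNoetherianRing (Z'.presheaf.stalk ξ') ∧
      (Fintype.card σ : WithBot ℕ∞) ≤ ringKrullDim (Z'.presheaf.stalk ξ') := by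
  classical
  set k := Fintype.card σ with hk
  set eσ : σ ≃ Fin k := Fintype.equivFin σ with heσ
  set c' : Fin k → Z.presheaf.stalk (π ξ') := c ∘ eσ.symm with hc'
  have hrange : Ideal.span (Set.range c') = Ideal.span (Set.range c) := span_range_comp_equiv eσ.symm c
  have hc'J : Ideal.span (Set.range c') = stalkIdeal J (π ξ') := hrange.trans hcJ
  have hz' : Ideal.span (Set.range c') = maximalIdeal _ := hrange.trans hc𝔪
  obtain ⟨j, 𝔴, χ, hχ, hloc, h𝔴⟩ := hπ.exists_reesChart_stalk ξ' c' hc'J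
  haveI : IsNoetherianRing (chartRing c' j) := isNoetherianRing_blowupChart c' j
  have hNoeth : IsNoetherianRing (Z'.presheaf.stalk ξ') := isNoetherianRing_of_chart 𝔴.asIdeal χ hloc
  have hτex : ∀ m : Fin k, ∃ r : Z.presheaf.stalk (π ξ'),
      χ (chartGen c' j m) - (π.stalkMap ξ').hom r ∈ maximalIdeal (Z'.presheaf.stalk ξ') :=
    fun m => hrat _
  choose τ' hτ' using hτex
  have hτ𝔴 : ∀ m, m ≠ j → chartGen c' j m - chartBase c' j (τ' m) ∈ 𝔴.asIdeal := by
    intro m _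
    refine mem_of_map_mem_maximalIdeal 𝔴.asIdeal χ hloc ?_
    have hms := map_sub χ (chartGen c' j m) (chartBase c' j (τ' m))
    rw [hms, hχ]
    exact hτ' m
  have hquasi : IsQuasiRegular c' := isQuasiRegular_rsop_comp hd c' hz' id Function.injective_id
  have hgen := span_range_eq_maximalIdeal_of_rational_chi c' j hz' (chartBase c' j) (chartGen c' j)
    (chartQuotEquiv c' j hquasi) (chartQuotMap_C c' j) (chartQuotMap_X c' j) 𝔴.asIdeal h𝔴 χ hloc τ' hτ𝔴
  have hdim := le_ringKrullDim_of_rational_chi c' j hz' hd (chartBase c' j) (chartGen c' j)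
    (reesChartBase_mem_nonZeroDivisors (c' j) (Ideal.mem_span_range_self (f := c') (x := j)))
    (chartQuotEquiv c' j hquasi) (chartQuotMap_C c' j) (chartQuotMap_X c' j) 𝔴.asIdeal h𝔴 χ hloc τ' hτ𝔴
  refine ⟨eσ.symm j, fun s => χ (chartGen c' j (eσ s)), fun s => τ' (eσ s), fun s => ?_, ?_, ?_, hNoeth, hdim⟩
  · have h1 : c s = c' (eσ s) := by rw [hc']; simp
    have h2 : c (eσ.symm j) = c' j := by rw [hc']; simp
    rw [h1, h2, ← hχ, ← hχ, reesChartBase_apply_eq_mul_chartGen c' j (eσ s), map_mul]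
  · -- `eᵢ = χ (cⱼ/cⱼ) = 1`
    dsimp only
    have h1 : chartGen c' j j = 1 := chartGen_self c' j
    rw [Equiv.apply_symm_apply, h1, map_one]
  · have hF : (fun s : σ => if s = eσ.symm j then (π.stalkMap ξ').hom (c (eσ.symm j))
        else χ (chartGen c' j (eσ s)) - (π.stalkMap ξ').hom (τ' (eσ s))) =
        (fun m : Fin k => if m = j then χ (chartBase c' j (c' j))
          else χ (chartGen c' j m) - χ (chartBase c' j (τ' m))) ∘ eσ := by
      funext s
      have h2 : c (eσ.symm j) = c' j := by rw [hc']; simp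
      by_cases hs : s = eσ.symm j
      · have hs' : eσ s = j := by rw [hs]; simp
        rw [Function.comp_apply, if_pos hs, if_pos hs', hχ, h2]
      · have hs' : eσ s ≠ j := fun h => hs (by rw [← h]; simp)
        rw [Function.comp_apply, if_neg hs, if_neg hs', hχ]
    exact (congrArg (fun F => Ideal.span (Set.range F)) hF).trans ((span_range_comp_equiv eσ _).trans hgen)

/-- A localisation map carries non-zero-divisors to non-zero-divisors (`χ`-form). [folklore] -/
theorem map_mem_nonZeroDivisors_of_chart {A L : Type u} [CommRing A] [CommRing L] (𝔓 : Ideal A) [𝔓.IsPrime]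
    (χ : A →+* L) (hloc : @IsLocalization.AtPrime _ _ L _ χ.toAlgebra 𝔓 _) {x : A}
    (hx : x ∈ nonZeroDivisors A) : χ x ∈ nonZeroDivisors L := by
  letI : Algebra A L := χ.toAlgebra
  haveI := hloc
  exact IsLocalization.nonZeroDivisors_le_comap 𝔓.primeCompl L hx

set_option maxHeartbeats 400000 in
/-- [OURS · L1 W4.6 — DICTIONARY, SCHEME HALF, brick 6, sharpened again; NOT a statement of the manuscript] The chart
data of `exists_stalk_chartData_one` together with: **the exceptional parameter `π^♯(cᵢ)` is a non-zero-divisor of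
`𝒪_{Z′,ξ′}`** (it is the image of the non-zero-divisor `cᵢ/1` of the Rees chart under a localisation map), as brick 12
(`stalkIdeal_transform_eq_span`) wants it. [cite: StacksProject, Tag 0804] [folklore] -/
theorem exists_stalk_chartData_nzd (hπ : IsBlowup π J) (ξ' : Z')
    [IsRegularLocalRing (Z.presheaf.stalk (π ξ'))] {σ : Type} [Fintype σ] [DecidableEq σ]
    (c : σ → Z.presheaf.stalk (π ξ'))
    (hcJ : Ideal.span (Set.range c) = stalkIdeal J (π ξ'))
    (hc𝔪 : Ideal.span (Set.range c) = maximalIdeal (Z.presheaf.stalk (π ξ')))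
    (hd : (maximalIdeal (Z.presheaf.stalk (π ξ'))).spanFinrank = Fintype.card σ)
    (hrat : ∀ y : Z'.presheaf.stalk ξ', ∃ r : Z.presheaf.stalk (π ξ'),
      y - (π.stalkMap ξ').hom r ∈ maximalIdeal (Z'.presheaf.stalk ξ')) :
    ∃ (i : σ) (e : σ → Z'.presheaf.stalk ξ') (τ : σ → Z.presheaf.stalk (π ξ')),
      (∀ j, (π.stalkMap ξ').hom (c j) = (π.stalkMap ξ').hom (c i) * e j) ∧ e i = 1 ∧
      (π.stalkMap ξ').hom (c i) ∈ nonZeroDivisors (Z'.presheaf.stalk ξ') ∧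
      Ideal.span (Set.range fun j : σ => if j = i then (π.stalkMap ξ').hom (c i)
        else e j - (π.stalkMap ξ').hom (τ j)) = maximalIdeal (Z'.presheaf.stalk ξ') ∧
      IsNoetherianRing (Z'.presheaf.stalk ξ') ∧
      (Fintype.card σ : WithBot ℕ∞) ≤ ringKrullDim (Z'.presheaf.stalk ξ') := by
  classical
  set k := Fintype.card σ with hk
  set eσ : σ ≃ Fin k := Fintype.equivFin σ with heσ
  set c' : Fin k → Z.presheaf.stalk (π ξ') := c ∘ eσ.symm with hc'
  have hrange : Ideal.span (Set.range c') = Ideal.span (Set.range c) := span_range_comp_equiv eσ.symm c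
  have hc'J : Ideal.span (Set.range c') = stalkIdeal J (π ξ') := hrange.trans hcJ
  have hz' : Ideal.span (Set.range c') = maximalIdeal _ := hrange.trans hc𝔪
  obtain ⟨j, 𝔴, χ, hχ, hloc, h𝔴⟩ := hπ.exists_reesChart_stalk ξ' c' hc'J
  haveI : IsNoetherianRing (chartRing c' j) := isNoetherianRing_blowupChart c' j
  have hNoeth : IsNoetherianRing (Z'.presheaf.stalk ξ') := isNoetherianRing_of_chart 𝔴.asIdeal χ hloc
  have hτex : ∀ m : Fin k, ∃ r : Z.presheaf.stalk (π ξ'),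
      χ (chartGen c' j m) - (π.stalkMap ξ').hom r ∈ maximalIdeal (Z'.presheaf.stalk ξ') :=
    fun m => hrat _
  choose τ' hτ' using hτex
  have hτ𝔴 : ∀ m, m ≠ j → chartGen c' j m - chartBase c' j (τ' m) ∈ 𝔴.asIdeal := by
    intro m _
    refine mem_of_map_mem_maximalIdeal 𝔴.asIdeal χ hloc ?_
    have hms := map_sub χ (chartGen c' j m) (chartBase c' j (τ' m))
    rw [hms, hχ]
    exact hτ' m
  have hquasi : IsQuasiRegular c' := isQuasiRegular_rsop_comp hd c' hz' id Function.injective_id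
  have hgen := span_range_eq_maximalIdeal_of_rational_chi c' j hz' (chartBase c' j) (chartGen c' j)
    (chartQuotEquiv c' j hquasi) (chartQuotMap_C c' j) (chartQuotMap_X c' j) 𝔴.asIdeal h𝔴 χ hloc τ' hτ𝔴
  have hdim := le_ringKrullDim_of_rational_chi c' j hz' hd (chartBase c' j) (chartGen c' j)
    (reesChartBase_mem_nonZeroDivisors (c' j) (Ideal.mem_span_range_self (f := c') (x := j)))
    (chartQuotEquiv c' j hquasi) (chartQuotMap_C c' j) (chartQuotMap_X c' j) 𝔴.asIdeal h𝔴 χ hloc τ' hτ𝔴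
  have hnzd : (π.stalkMap ξ').hom (c (eσ.symm j)) ∈ nonZeroDivisors (Z'.presheaf.stalk ξ') := by
    have h2 : c (eσ.symm j) = c' j := by rw [hc']; simp
    rw [h2, ← hχ]
    exact map_mem_nonZeroDivisors_of_chart 𝔴.asIdeal χ hloc
      (reesChartBase_mem_nonZeroDivisors (c' j) (Ideal.mem_span_range_self (f := c') (x := j)))
  refine ⟨eσ.symm j, fun s => χ (chartGen c' j (eσ s)), fun s => τ' (eσ s), fun s => ?_, ?_, hnzd, ?_, hNoeth, hdim⟩
  · have h1 : c s = c' (eσ s) := by rw [hc']; simp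
    have h2 : c (eσ.symm j) = c' j := by rw [hc']; simp
    rw [h1, h2, ← hχ, ← hχ, reesChartBase_apply_eq_mul_chartGen c' j (eσ s), map_mul]
  · dsimp only
    have h1 : chartGen c' j j = 1 := chartGen_self c' j
    rw [Equiv.apply_symm_apply, h1, map_one]
  · have hF : (fun s : σ => if s = eσ.symm j then (π.stalkMap ξ').hom (c (eσ.symm j))
        else χ (chartGen c' j (eσ s)) - (π.stalkMap ξ').hom (τ' (eσ s))) =
        (fun m : Fin k => if m = j then χ (chartBase c' j (c' j))
          else χ (chartGen c' j m) - χ (chartBase c' j (τ' m))) ∘ eσ := by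
      funext s
      have h2 : c (eσ.symm j) = c' j := by rw [hc']; simp
      by_cases hs : s = eσ.symm j
      · have hs' : eσ s = j := by rw [hs]; simp
        rw [Function.comp_apply, if_pos hs, if_pos hs', hχ, h2]
      · have hs' : eσ s ≠ j := fun h => hs (by rw [← h]; simp)
        rw [Function.comp_apply, if_neg hs, if_neg hs', hχ]
    exact (congrArg (fun F => Ideal.span (Set.range F)) hF).trans ((span_range_comp_equiv eσ _).trans hgen)

end CampaignW46.ChartPoint

end Summit.ResolutionOfSingularities.ResolutionOfSingularities.Theorems

end
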